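/- Width seat `ym-line-sfw-p2-w5` (prover-ym-line-sfw-p2-w5-g18-0), free hands for planner ym-idea-2's STUB-PLAN-E §5 (LINE-17 on crux
`AllWindowsColdBox.BoxMidWindowsSU22` = stmt-QuantumFields-24003, stub F `stub_gaussSideTerms`): the cubic Taylor term of ONE plaquette cost. -/
import Summits.QuantumFields.YangMills.Theorems.AllWindowsColdBoxTiltCubicOnForm

/-!
# The cubic Taylor term of a single plaquette cost is `tiltCubicOn ρ H {q}` (STUB-PLAN-E §5, obligation F)

For one plaquette `q` touching the cold box, the cubic term of the sub-family `{q}` is the per-plaquette cubic term of E(0)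
(`tiltCubicOn_singleton`), so the landed quartic-remainder estimate `abs_qObsD_sub_beta_mul_plaqCostAt_sub_cubic_le` reads

  `|qObsD q t − β·plaqCostAt ρ q (cfgTE ρ H β t) − tiltCubicOn ρ H {q} β t| ≤ 560·β·(‖a₁‖⁴ + ‖a₂‖⁴ + ‖a₃‖⁴ + ‖a₄‖⁴)`

(`abs_qObsD_sub_beta_mul_plaqCostAt_sub_tiltCubicOn_singleton_le`; `a = extZero (unscaleTE H D β t)`, legs in path order).  This is the
decomposition `β·cost_q = qObsD q − tiltCubicOn {q} + R₄` of the observables `obsF`/`obsG` of obligation F, whose cubic part has the Gaussian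
moments of `AllWindowsColdBoxTiltCubicOnVariance` with `#S = 1` and is ODD in `t` (`tiltCubicOn_neg`, `tiltCubicW_neg`: the parity input of F).  Everything proved; no definition; standard axioms.  HONEST LABEL: helper toward
the open registered stub F of a critic-passed line on the R2ξ″ RECORD-rung crux 24003; no stub is proved by name, no crux, rung or summit is proved;
the Yang–Mills mass gap is NOT proved by this file.
-/

set_option autoImplicit false

noncomputable section

open MeasureTheory Finset
open Literature.Probability.LatticeModels (Site)
open Literature.MathematicalPhysics.QuantumLattice
open Literature.MathematicalPhysics.QuantumFieldTheory
open Literature.MathematicalPhysics.QuantumFieldTheory.LatticeMaxwell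
open Literature.MathematicalPhysics.QuantumFieldTheory.AxialGauge
open Summit.QuantumFields.YangMills.Theorems.WeakCouplingRates
open Summit.QuantumFields.YangMills.Theorems.FreeEnergyLogCoefficient

namespace Summit.QuantumFields.YangMills.Theorems.ColdBoxAllGroups

variable {N : ℕ} {G : Type*} [Group G] (ρ : G →* Matrix (Fin N) (Fin N) ℂ) {H : ℕ}

/-- **The cubic term of a single plaquette** `q`: `tiltCubicOn ρ H {q} β t = β·½(T(s,a₁,a₂) − T(s,a₁,a₃) − T(s,a₁,a₄) − T(s,a₂,a₃) − T(s,a₂,a₄) +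
T(s,a₃,a₄))`. -/
theorem tiltCubicOn_singleton (q : ZdPlaquette 4) (β : ℝ) (t : TSpaceD H (dimE ρ)) :
    tiltCubicOn ρ H {q} β t =
      β * ((chartCubic ρ (circV (extZero (unscaleTE H (dimE ρ) β t)) (q.1, q.2.1.1, q.2.1.2))
          (extZero (unscaleTE H (dimE ρ) β t) (q.1, q.2.1.1))
          (extZero (unscaleTE H (dimE ρ) β t) (q.1 + Pi.single q.2.1.1 1, q.2.1.2)) -
        chartCubic ρ (circV (extZero (unscaleTE H (dimE ρ) β t)) (q.1, q.2.1.1, q.2.1.2))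
          (extZero (unscaleTE H (dimE ρ) β t) (q.1, q.2.1.1))
          (extZero (unscaleTE H (dimE ρ) β t) (q.1 + Pi.single q.2.1.2 1, q.2.1.1)) -
        chartCubic ρ (circV (extZero (unscaleTE H (dimE ρ) β t)) (q.1, q.2.1.1, q.2.1.2))
          (extZero (unscaleTE H (dimE ρ) β t) (q.1, q.2.1.1)) (extZero (unscaleTE H (dimE ρ) β t) (q.1, q.2.1.2)) -
        chartCubic ρ (circV (extZero (unscaleTE H (dimE ρ) β t)) (q.1, q.2.1.1, q.2.1.2))
          (extZero (unscaleTE H (dimE ρ) β t) (q.1 + Pi.single q.2.1.1 1, q.2.1.2))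
          (extZero (unscaleTE H (dimE ρ) β t) (q.1 + Pi.single q.2.1.2 1, q.2.1.1)) -
        chartCubic ρ (circV (extZero (unscaleTE H (dimE ρ) β t)) (q.1, q.2.1.1, q.2.1.2))
          (extZero (unscaleTE H (dimE ρ) β t) (q.1 + Pi.single q.2.1.1 1, q.2.1.2))
          (extZero (unscaleTE H (dimE ρ) β t) (q.1, q.2.1.2)) +
        chartCubic ρ (circV (extZero (unscaleTE H (dimE ρ) β t)) (q.1, q.2.1.1, q.2.1.2))
          (extZero (unscaleTE H (dimE ρ) β t) (q.1 + Pi.single q.2.1.2 1, q.2.1.1))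
          (extZero (unscaleTE H (dimE ρ) β t) (q.1, q.2.1.2))) / 2) := by
  rw [tiltCubicOn, Finset.sum_singleton]

/-- **Parity: the cubic term is ODD** under `t ↦ −t` (`β > 0`): `tiltCubicOn ρ H S β (−t) = −tiltCubicOn ρ H S β t` — with the symmetry of
`gaussD` (`integral_gaussD_eq_zero_of_odd`, `integral_gaussD_even_mul_odd`) this kills the `(even)·(cubic)` cross terms of obligation F. -/
theorem tiltCubicOn_neg (S : Finset (ZdPlaquette 4)) {β : ℝ} (hβ : 0 < β) (t : TSpaceD H (dimE ρ)) :
    tiltCubicOn ρ H S β (-t) = -tiltCubicOn ρ H S β t := by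
  rw [tiltCubicOn_eq_inv_sqrt_mul_cubicForm ρ S hβ, tiltCubicOn_eq_inv_sqrt_mul_cubicForm ρ S hβ, ← mul_neg]
  congr 1
  simp only [Pi.neg_apply, WithLp.ofLp_neg, mul_neg, neg_mul, neg_neg, Finset.sum_neg_distrib]

/-- In particular the full cubic part of the tilt is odd. -/
theorem tiltCubicW_neg {β : ℝ} (hβ : 0 < β) (t : TSpaceD H (dimE ρ)) : tiltCubicW ρ H β (-t) = -tiltCubicW ρ H β t := by
  rw [tiltCubicW_eq_tiltCubicOn, tiltCubicW_eq_tiltCubicOn, tiltCubicOn_neg ρ _ hβ]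

variable [TopologicalSpace G] [CompactSpace G]

/-- **`β·cost_q = qObsD q − tiltCubicOn {q} + O(Σ_legs ‖a‖⁴)` for one plaquette**: for a continuous unitary-valued `ρ`, `β > 0` and a colour
tuple all of whose chart coordinates have norm `≤ 1/4`,
`|qObsD q t − β·plaqCostAt ρ q (cfgTE ρ H β t) − tiltCubicOn ρ H {q} β t| ≤ 560·β·(‖a₁‖⁴ + ‖a₂‖⁴ + ‖a₃‖⁴ + ‖a₄‖⁴)` (the landed E(0) remainder
`abs_qObsD_sub_beta_mul_plaqCostAt_sub_cubic_le`, restated with `tiltCubicOn_singleton`). -/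
theorem abs_qObsD_sub_beta_mul_plaqCostAt_sub_tiltCubicOn_singleton_le (hρ : Continuous ρ) {β : ℝ} (hβ : 0 < β)
    (t : TSpaceD H (dimE ρ)) (ht : ∀ e, ‖unscaleTE H (dimE ρ) β t e‖ ≤ 1 / 4) (q : ZdPlaquette 4) :
    |qObsD H (dimE ρ) (q.1, q.2.1.1, q.2.1.2) t - β * plaqCostAt ρ q.1 q.2.1.1 q.2.1.2 (cfgTE ρ H β t) - tiltCubicOn ρ H {q} β t| ≤
      560 * β * (‖extZero (unscaleTE H (dimE ρ) β t) (q.1, q.2.1.1)‖ ^ 4 +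
        ‖extZero (unscaleTE H (dimE ρ) β t) (q.1 + Pi.single q.2.1.1 1, q.2.1.2)‖ ^ 4 +
        ‖extZero (unscaleTE H (dimE ρ) β t) (q.1 + Pi.single q.2.1.2 1, q.2.1.1)‖ ^ 4 +
        ‖extZero (unscaleTE H (dimE ρ) β t) (q.1, q.2.1.2)‖ ^ 4) := by
  rw [tiltCubicOn_singleton]
  exact abs_qObsD_sub_beta_mul_plaqCostAt_sub_cubic_le ρ hρ hβ t ht q.1 q.2.1.1 q.2.1.2

end Summit.QuantumFields.YangMills.Theorems.ColdBoxAllGroups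

end
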